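import Literature.Computability.Complexity.EasyWitness
import Literature.Computability.Complexity.KannanLanguageAE
import Literature.Computability.Complexity.ExpMACollapse
import Literature.Computability.Complexity.SumcheckHonestProver
import HarnessLib

/-!
# The easy witness method: discharged ingredients

Proof companion of `EasyWitness.lean` (the reduction of Impagliazzo–Kabanets–Wigderson's
`NEXP ⊆ P/poly ⟹ NEXP = EXP`, IKW 2002 Thm. 24 / Arora–Barak Lemma 20.20, to four named facts).
This file discharges the ingredients that the tree can prove, starting with

* `IKW2002_thm2_holds` — **IKW Theorem 2, `EXP ⊄ io-SIZE(n^c)` for every fixed `c`**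
  (almost-everywhere `SIZE`): the witness is Kannan's diagonal language `L_{c+1} ∈ Σ₄ᵖ ⊆ EXP`,
  hard at every large length (`exists_mem_EXP_eventually_lt_circuitSize`,
  `KannanLanguageAE.lean`), in place of IKW's lexicographically first hard circuit;

and records the correspondingly shortened trust base of the fact
`NEXP_eq_EXP_of_subset_PPoly` (`NEXP_eq_EXP_of_subset_PPoly_of_IKW₃`: Thm. 22, Thm. 18 (`MA`
case) and Lemma 5 remain).

## References

* R. Impagliazzo, V. Kabanets, A. Wigderson, *In search of an easy witness: exponential time vs.
  probabilistic polynomial time*, JCSS 65 (2002) 672–694, Thm. 2, Lemma 5, Thms. 18, 22, 24.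
* R. Kannan, *Circuit-size lower bounds and non-reducibility to sparse sets*, Inform. Control 55
  (1982) 40–56, Lemma 1.
* S. Arora, B. Barak, *Computational Complexity: A Modern Approach*, CUP 2009, Lemma 20.20.
-/

noncomputable section

namespace Literature.Computability.Complexity

/-- **Discharge of `IKW2002_thm2`** (IKW 2002, Thm. 2: for every fixed `c`, `EXP ⊄ io-SIZE(n^c)`,
almost-everywhere `SIZE`): Kannan's `L_{c+1} ∈ Σ₄ᵖ ⊆ EXP` has circuit complexity `> n^c` at every
sufficiently large length (`exists_mem_EXP_eventually_lt_circuitSize`).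
[cite: ImpagliazzoKabanetsWigderson2002, Thm. 2] -/
theorem IKW2002_thm2_holds : IKW2002_thm2 :=
  exists_mem_EXP_eventually_lt_circuitSize

/-- **IKW Theorem 24 / Arora–Barak Lemma 20.20 on three named facts**: with Thm. 2 discharged,
`NEXP ⊆ P/poly ⟹ NEXP = EXP` follows from `EXP_eq_MA_of_subset_PPoly` (IKW Thm. 22),
`IKW2002_thm18_MA` (IKW Thm. 18, `MA` case) and `IKW2002_lemma5` (IKW Lemma 5).
(Printed proof: `EXP = AM = MA` by Thm. 22, Thm. 18 for `AM`; here via the `MA` leaf.)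
[cite: ImpagliazzoKabanetsWigderson2002, Thm. 24] [cite: AroraBarakCC2009, Lemma 20.20 (p. 417)] -/
theorem NEXP_eq_EXP_of_subset_PPoly_of_IKW₃ (h22 : EXP_eq_MA_of_subset_PPoly)
    (h18 : IKW2002_thm18_MA) (h5 : IKW2002_lemma5) : NEXP_eq_EXP_of_subset_PPoly :=
  NEXP_eq_EXP_of_subset_PPoly_of_IKW h22 h18 h5 IKW2002_thm2_holds

/-! ### Discharge of `EXP_eq_MA_of_subset_PPoly` (IKW Thm. 22 = Arora–Barak Lemma 20.18) -/

/-- **`EXP ⊆ P/poly ⟹ EXP = MA` — discharged** (Impagliazzo–Kabanets–Wigderson Thm. 22, crediting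
Babai–Fortnow–Lund 1991 and Babai–Fortnow–Nisan–Wigderson 1993; Arora–Barak Lemma 20.18, PDF p. 488).
The tree's proof follows the printed architecture — Meyer's theorem collapses `EXP` to `Σ₂ᵖ`
(`EXP_eq_SigmaP_two_of_subset_PPoly_holds`), an interactive proof whose honest prover is an
exponential-time machine is turned into a Merlin–Arthur game by letting Merlin send the prover's
polynomial-size circuits (which exist under the hypothesis) and Arthur replay the interaction —
with the interactive proof taken to be the sumcheck protocol for `SAT̄` of Arora–Barak Thm. 8.21
(run over `ℤ`) instead of the one for `TQBF`: `SumcheckCNF.lean`, `SumcheckMASpec.lean`,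
`SumcheckMAReferee.lean` (Arthur is polynomial time), `SumcheckMAGame.lean` (soundness by the
at-most-`d`-roots argument and the fresh-block union bound; completeness), `SumcheckHonestProver.lean`
(the honest prover's bit graph is in `EXP`, hence in `P/poly`; so `UNSAT ∈ MA`), and
`ExpMACollapse.lean` (`coNP ≤ₚ UNSAT`, `MA` absorbs `∃ᵖ` of a reduction, so `Σ₂ᵖ = ∃ᵖ·coNP ⊆ MA`;
`MA ⊆ ∃ᵖ·PP ⊆ PSPACE ⊆ EXP`). [cite: ImpagliazzoKabanetsWigderson2002, Thm. 22]
[cite: AroraBarakCC2009, Lemma 20.18 (PDF p. 488) with Thm. 8.21 and Thm. 8.22] -/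
theorem EXP_eq_MA_of_subset_PPoly_holds : EXP_eq_MA_of_subset_PPoly := fun h =>
  ExpMA.EXP_eq_MA_of_subset_PPoly_of_UNSAT_mem_MA (SumcheckMA.UNSAT_mem_MA_of_EXP_subset_PPoly h) h

end Literature.Computability.Complexity

end
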